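import Summits.CriticalPhenomena.PercolationContinuityZ3.Theorems.PercNearOneGluingNoHeavyLowerTailAntipodalR1IrredTools
import Summits.CriticalPhenomena.PercolationContinuityZ3.Theorems.PercNearOneGluingNoHeavyLowerTailAntipodalR1CutVertexGraded
import Summits.CriticalPhenomena.PercolationContinuityZ3.Theorems.PercNearOneGluingNoHeavyLowerTailAntipodalR1OneSumApexGraded
import Summits.CriticalPhenomena.PercolationContinuityZ3.Theorems.PercNearOneGluingNoHeavyLowerTailAntipodalR1OneSumTerminalGraded
import Summits.CriticalPhenomena.PercolationContinuityZ3.Theorems.PercNearOneGluingNoHeavyLowerTailAntipodalR1OneSumApexCutGraded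
import Summits.CriticalPhenomena.PercolationContinuityZ3.Theorems.PercNearOneGluingNoHeavyLowerTailAntipodalR1TwoCutContractGraded
import Summits.CriticalPhenomena.PercolationContinuityZ3.Theorems.PercNearOneGluingNoHeavyLowerTailAntipodalR1LemmaF
import HarnessLib

/-!
# ANTI₁-GRADED reduces to irreducible instances; LEMMA F from irreducible instances

Support file for `stmt-CriticalPhenomena-4575` (memo `prim-gen-kcluster/KCLUSTER-gen78.md` §1.5, §4, §7 N1).
No definitions, no named facts, no sorries.

An instance `(ends : ι → Sym2 V; a, b, c)` is *reducible* if it is degenerate (two of `a, b, c` coincide, or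
one of them is met by no edge), or its edge set splits as a 1-sum (`S ⊔ Sᶜ`, both parts non-empty, every
vertex met by both parts equal to one vertex `h`), or it has a 2-separation `{u, v}`, `u ≠ v`, one of whose
sides has at least two edges and meets `a, b, c` only in `u, v`.  By the reduction theorems of gen 78
(`card_lSet_grade_le_of_cutVertex / _of_apexBlock / _of_terminalBlock / _of_terminalCut`,
`card_lSet_grade_eq_card_rSet_of_apexCut`, `card_lSet_grade_le_of_twoCut'`) and strong induction on the
number of edges:

* **`card_lSet_grade_le_of_irreducible`** — if the level inequality `#{x ∈ L, g x = t} ≤ #{x ∈ R, g x = t}`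
  holds for every IRREDUCIBLE instance on `V` (hypothesis `Hirr`, irreducibility spelled out as the
  negation of the splittings above), it holds for every finite edge system on `V`;
* **`r1_rc_of_irreducible_graded_anti1`** — hence (LEMMA F, `r1_rc_of_graded_anti1`) the refined row R1
  for `rcMeasureW w q ∅`, every `q > 0`, follows from ANTI₁-GRADED on irreducible instances alone.
[this work]
-/

namespace Summit.CriticalPhenomena.PercolationContinuityZ3.Theorems

namespace AntipodalR1

open Finset Relation SimpleGraph

universe u₀

variable {V : Type u₀} [Fintype V] [DecidableEq V]

section OneSum

variable {κ : Type u₀} [Fintype κ] [DecidableEq κ]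

open Classical in
/-- **The 1-sum step of the induction.**  If the edges split as `S ⊔ Sᶜ` with every vertex met by both
parts equal to `h`, the instance is non-degenerate, the apex is `h` or is met by `S`, and the level
inequalities hold for both parts (all placements of the terminals), then they hold for the whole system.
Case analysis over the positions of `b, c` relative to the cut vertex, each case being one of the
cut-vertex reductions of gen 78. [this work] -/
theorem card_lSet_grade_le_of_oneSum (ends : κ → Sym2 V) (a b c : V) (S : Finset κ) (h : V)
    (hmeet : ∀ w, (∃ i ∈ S, w ∈ ends i) → (∃ j ∉ S, w ∈ ends j) → w = h)
    (hab : a ≠ b) (hac : a ≠ c) (hbc : b ≠ c)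
    (hmb : ∃ i, b ∈ ends i) (hmc : ∃ i, c ∈ ends i)
    (haS : a = h ∨ ∃ i ∈ S, a ∈ ends i)
    (IHS : ∀ (a' b' c' : V) (t : ℕ),
      (univ.filter fun x : {i // i ∈ S} → Bool => x ∈ lSet (fun i : {i // i ∈ S} => ends ↑i) a' b' c' ∧
        (Nat.card (fromEdgeSet {s : Sym2 V | ∃ i, x i = true ∧ (fun i : {i // i ∈ S} => ends ↑i) i = s}).ConnectedComponent +
        Nat.card (fromEdgeSet {s : Sym2 V | ∃ i, x i = false ∧ (fun i : {i // i ∈ S} => ends ↑i) i = s}).ConnectedComponent) =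
          t).card ≤
      (univ.filter fun x : {i // i ∈ S} → Bool => x ∈ rSet (fun i : {i // i ∈ S} => ends ↑i) a' b' c' ∧
        (Nat.card (fromEdgeSet {s : Sym2 V | ∃ i, x i = true ∧ (fun i : {i // i ∈ S} => ends ↑i) i = s}).ConnectedComponent +
        Nat.card (fromEdgeSet {s : Sym2 V | ∃ i, x i = false ∧ (fun i : {i // i ∈ S} => ends ↑i) i = s}).ConnectedComponent) =
          t).card)
    (IHSc : ∀ (a' b' c' : V) (t : ℕ),
      (univ.filter fun x : {i // i ∉ S} → Bool => x ∈ lSet (fun i : {i // i ∉ S} => ends ↑i) a' b' c' ∧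
        (Nat.card (fromEdgeSet {s : Sym2 V | ∃ i, x i = true ∧ (fun i : {i // i ∉ S} => ends ↑i) i = s}).ConnectedComponent +
        Nat.card (fromEdgeSet {s : Sym2 V | ∃ i, x i = false ∧ (fun i : {i // i ∉ S} => ends ↑i) i = s}).ConnectedComponent) =
          t).card ≤
      (univ.filter fun x : {i // i ∉ S} → Bool => x ∈ rSet (fun i : {i // i ∉ S} => ends ↑i) a' b' c' ∧
        (Nat.card (fromEdgeSet {s : Sym2 V | ∃ i, x i = true ∧ (fun i : {i // i ∉ S} => ends ↑i) i = s}).ConnectedComponent +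
        Nat.card (fromEdgeSet {s : Sym2 V | ∃ i, x i = false ∧ (fun i : {i // i ∉ S} => ends ↑i) i = s}).ConnectedComponent) =
          t).card)
    (t : ℕ) :
    (univ.filter fun x : κ → Bool => x ∈ lSet ends a b c ∧
        (Nat.card (fromEdgeSet {s : Sym2 V | ∃ i, x i = true ∧ ends i = s}).ConnectedComponent +
        Nat.card (fromEdgeSet {s : Sym2 V | ∃ i, x i = false ∧ ends i = s}).ConnectedComponent) =
          t).card ≤
      (univ.filter fun x : κ → Bool => x ∈ rSet ends a b c ∧
        (Nat.card (fromEdgeSet {s : Sym2 V | ∃ i, x i = true ∧ ends i = s}).ConnectedComponent +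
        Nat.card (fromEdgeSet {s : Sym2 V | ∃ i, x i = false ∧ ends i = s}).ConnectedComponent) =
          t).card := by
  -- the two Sum presentations of the system and their level counts
  have hendsA : ∀ i', (Sum.elim (fun i : {i // i ∈ S} => ends ↑i) (fun i : {i // i ∉ S} => ends ↑i)) i' = ends ((Equiv.sumCompl fun i => i ∈ S) i') := by
    rintro (i | i) <;> simp
  have hendsB : ∀ i', (Sum.elim (fun i : {i // i ∉ S} => ends ↑i) (fun i : {i // i ∈ S} => ends ↑i)) i' =
      ends (((Equiv.sumComm _ _).trans (Equiv.sumCompl fun i => i ∈ S)) i') := by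
    rintro (i | i) <;> simp
  have eqLA := fun a b c t => card_lSet_grade_eq_of_equiv (Equiv.sumCompl fun i => i ∈ S) ends
    (Sum.elim (fun i : {i // i ∈ S} => ends ↑i) (fun i : {i // i ∉ S} => ends ↑i)) hendsA a b c t
  have eqRA := fun a b c t => card_rSet_grade_eq_of_equiv (Equiv.sumCompl fun i => i ∈ S) ends
    (Sum.elim (fun i : {i // i ∈ S} => ends ↑i) (fun i : {i // i ∉ S} => ends ↑i)) hendsA a b c t
  have eqLB := fun a b c t => card_lSet_grade_eq_of_equiv
    ((Equiv.sumComm _ _).trans (Equiv.sumCompl fun i => i ∈ S)) ends (Sum.elim (fun i : {i // i ∉ S} => ends ↑i) (fun i : {i // i ∈ S} => ends ↑i)) hendsB a b c t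
  have eqRB := fun a b c t => card_rSet_grade_eq_of_equiv
    ((Equiv.sumComm _ _).trans (Equiv.sumCompl fun i => i ∈ S)) ends (Sum.elim (fun i : {i // i ∉ S} => ends ↑i) (fun i : {i // i ∈ S} => ends ↑i)) hendsB a b c t
  have hsepA : ∀ w (i : {i // i ∈ S}), w ∈ ends ↑i → ∀ (j : {i // i ∉ S}), w ∈ ends ↑j → w = h :=
    fun w i hi j hj => hmeet w ⟨i.1, i.2, hi⟩ ⟨j.1, j.2, hj⟩
  have hsepB : ∀ w (j : {i // i ∉ S}), w ∈ ends ↑j → ∀ (i : {i // i ∈ S}), w ∈ ends ↑i → w = h :=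
    fun w j hj i hi => hmeet w ⟨i.1, i.2, hi⟩ ⟨j.1, j.2, hj⟩
  -- a terminal other than `h` is met by one part only
  have onlyS : ∀ x, x ≠ h → (∃ i ∈ S, x ∈ ends i) → ∀ (j : {i // i ∉ S}), x ∈ ends ↑j → False :=
    fun x hx hxS j hj => hx (hmeet x hxS ⟨j.1, j.2, hj⟩)
  have onlySc : ∀ x, x ≠ h → (∃ j ∉ S, x ∈ ends j) → ∀ (i : {i // i ∈ S}), x ∈ ends ↑i → False :=
    fun x hx hxSc i hi => hx (hmeet x ⟨i.1, i.2, hi⟩ hxSc)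
  have metS : ∀ x, (∃ i, x ∈ ends i) → (¬ ∃ i ∈ S, x ∈ ends i) → ∃ j ∉ S, x ∈ ends j := by
    rintro x ⟨i, hi⟩ hxS
    by_cases hiS : i ∈ S
    · exact absurd ⟨i, hiS, hi⟩ hxS
    · exact ⟨i, hiS, hi⟩
  by_cases hah : a = h
  · -- the apex is the cut vertex
    subst hah
    by_cases hbS : ∃ i ∈ S, b ∈ ends i
    · by_cases hcS : ∃ i ∈ S, c ∈ ends i
      · -- b, c on the S-side: cut-vertex reduction to S
        rw [← eqLA a b c t, ← eqRA a b c t]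
        exact card_lSet_grade_le_of_cutVertex (fun i : {i // i ∈ S} => ends ↑i) (fun i : {i // i ∉ S} => ends ↑i) a a b c hsepA (fun _ _ => rfl)
          (fun j hj => (onlyS b (Ne.symm hab) hbS j hj).elim)
          (fun j hj => (onlyS c (Ne.symm hac) hcS j hj).elim) (IHS a b c) t
      · -- b on the S-side, c inside the other side: apex cut, equality
        obtain ⟨j, hjS, hjc⟩ := metS c hmc hcS
        rw [← eqLA a b c t, ← eqRA a b c t]
        exact le_of_eq (card_lSet_grade_eq_card_rSet_of_apexCut (fun i : {i // i ∈ S} => ends ↑i) (fun i : {i // i ∉ S} => ends ↑i) a b c hsepA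
          (fun j hj => (onlyS b (Ne.symm hab) hbS j hj).elim) ⟨⟨j, hjS⟩, hjc⟩ (Ne.symm hac) t)
    · obtain ⟨j, hjS, hjb⟩ := metS b hmb hbS
      by_cases hcS : ∃ i ∈ S, c ∈ ends i
      · -- c on the S-side, b inside the other side: apex cut after exchanging b and c
        rw [card_lSet_grade_comm ends a b c t, card_rSet_grade_comm ends a b c t,
          ← eqLA a c b t, ← eqRA a c b t]
        exact le_of_eq (card_lSet_grade_eq_card_rSet_of_apexCut (fun i : {i // i ∈ S} => ends ↑i) (fun i : {i // i ∉ S} => ends ↑i) a c b hsepA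
          (fun j hj => (onlyS c (Ne.symm hac) hcS j hj).elim) ⟨⟨j, hjS⟩, hjb⟩ (Ne.symm hab) t)
      · -- b, c inside the other side: cut-vertex reduction to Sᶜ
        have hcSc := metS c hmc hcS
        rw [← eqLB a b c t, ← eqRB a b c t]
        exact card_lSet_grade_le_of_cutVertex (fun i : {i // i ∉ S} => ends ↑i) (fun i : {i // i ∈ S} => ends ↑i) a a b c hsepB (fun _ _ => rfl)
          (fun i hi => (onlySc b (Ne.symm hab) ⟨j, hjS, hjb⟩ i hi).elim)
          (fun i hi => (onlySc c (Ne.symm hac) hcSc i hi).elim) (IHSc a b c) t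
  · -- `a ≠ h` is met by `S` only
    have haS : ∃ i ∈ S, a ∈ ends i := haS.resolve_left hah
    have haSc : ∀ (j : {i // i ∉ S}), a ∈ ends ↑j → a = h :=
      fun j hj => (onlyS a hah haS j hj).elim
    -- positions of b and c: `h`, strictly on the S-side, or strictly inside Sᶜ
    by_cases hbSc : ∃ j ∉ S, b ∈ ends j
    · by_cases hcSc : ∃ j ∉ S, c ∈ ends j
      · by_cases hbh : b = h
        · -- b = h is the cut vertex separating a from c: L = ∅ (terminal cut)
          subst hbh
          obtain ⟨j, hjS, hjc⟩ := hcSc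
          rw [← eqLA a b c t, ← eqRA a b c t]
          exact card_lSet_grade_le_of_terminalCut (fun i : {i // i ∈ S} => ends ↑i) (fun i : {i // i ∉ S} => ends ↑i) a b c hsepA haSc ⟨⟨j, hjS⟩, hjc⟩
            (Ne.symm hbc) t
        by_cases hch : c = h
        · -- c = h separates a from b: exchange b and c, terminal cut
          subst hch
          obtain ⟨j, hjS, hjb⟩ := hbSc
          rw [card_lSet_grade_comm ends a b c t, card_rSet_grade_comm ends a b c t,
            ← eqLA a c b t, ← eqRA a c b t]
          exact card_lSet_grade_le_of_terminalCut (fun i : {i // i ∈ S} => ends ↑i) (fun i : {i // i ∉ S} => ends ↑i) a c b hsepA haSc ⟨⟨j, hjS⟩, hjb⟩ hbc t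
        · -- b, c strictly inside Sᶜ: apex block, reduction to (Sᶜ; h, b, c)
          obtain ⟨j, hjS, hjb⟩ := hbSc
          obtain ⟨j', hj'S, hj'c⟩ := hcSc
          rw [← eqLA a b c t, ← eqRA a b c t]
          exact card_lSet_grade_le_of_apexBlock (fun i : {i // i ∈ S} => ends ↑i) (fun i : {i // i ∉ S} => ends ↑i) h a b c hsepA haSc ⟨⟨j, hjS⟩, hjb⟩ hbh
            ⟨⟨j', hj'S⟩, hj'c⟩ hch (IHSc h b c) t
      · -- c on the S-side (or = h, met by S only); b met by Sᶜ
        have hcS' : ∀ (j : {i // i ∉ S}), c ∈ ends ↑j → c = h :=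
          fun j hj => (hcSc ⟨j.1, j.2, hj⟩).elim
        by_cases hbh : b = h
        · -- then b = h is met by both… b = h, c on the S-side, a on the S-side: cut vertex to S
          rw [← eqLA a b c t, ← eqRA a b c t]
          exact card_lSet_grade_le_of_cutVertex (fun i : {i // i ∈ S} => ends ↑i) (fun i : {i // i ∉ S} => ends ↑i) h a b c hsepA haSc
            (fun _ _ => hbh) hcS' (IHS a b c) t
        · -- b strictly inside Sᶜ, c on the S-side: exchange, terminal block to (S; a, c, h)
          obtain ⟨j, hjS, hjb⟩ := hbSc
          rw [card_lSet_grade_comm ends a b c t, card_rSet_grade_comm ends a b c t,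
            ← eqLA a c b t, ← eqRA a c b t]
          exact card_lSet_grade_le_of_terminalBlock (fun i : {i // i ∈ S} => ends ↑i) (fun i : {i // i ∉ S} => ends ↑i) h a c b hsepA haSc hcS'
            ⟨⟨j, hjS⟩, hjb⟩ hbh (IHS a c h) t
    · -- b met by S only
      have hbS' : ∀ (j : {i // i ∉ S}), b ∈ ends ↑j → b = h :=
        fun j hj => (hbSc ⟨j.1, j.2, hj⟩).elim
      by_cases hcSc : ∃ j ∉ S, c ∈ ends j
      · by_cases hch : c = h
        · -- c = h: all terminals on the S-side: cut vertex to S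
          rw [← eqLA a b c t, ← eqRA a b c t]
          exact card_lSet_grade_le_of_cutVertex (fun i : {i // i ∈ S} => ends ↑i) (fun i : {i // i ∉ S} => ends ↑i) h a b c hsepA haSc hbS'
            (fun _ _ => hch) (IHS a b c) t
        · -- c strictly inside Sᶜ: terminal block to (S; a, b, h)
          obtain ⟨j, hjS, hjc⟩ := hcSc
          rw [← eqLA a b c t, ← eqRA a b c t]
          exact card_lSet_grade_le_of_terminalBlock (fun i : {i // i ∈ S} => ends ↑i) (fun i : {i // i ∉ S} => ends ↑i) h a b c hsepA haSc hbS'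
            ⟨⟨j, hjS⟩, hjc⟩ hch (IHS a b h) t
      · -- b and c on the S-side: cut vertex to S
        have hcS' : ∀ (j : {i // i ∉ S}), c ∈ ends ↑j → c = h :=
          fun j hj => (hcSc ⟨j.1, j.2, hj⟩).elim
        rw [← eqLA a b c t, ← eqRA a b c t]
        exact card_lSet_grade_le_of_cutVertex (fun i : {i // i ∈ S} => ends ↑i) (fun i : {i // i ∉ S} => ends ↑i) h a b c hsepA haSc hbS' hcS' (IHS a b c) t

end OneSum
section Induction

open Classical in
/-- **ANTI₁-GRADED reduces to irreducible instances.**  Suppose the level inequality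
`#{x ∈ L, g x = t} ≤ #{x ∈ R, g x = t}` holds for every instance `(ends : ι → Sym2 V; a, b, c)` on `V` that is
IRREDUCIBLE: `a, b, c` pairwise distinct and each met by an edge, no 1-sum splitting of the edges, and
no 2-separation `{u, v}`, `u ≠ v`, with a side of `≥ 2` edges meeting `a, b, c` only in `u, v` (both
spelled out as negated existentials over `Finset ι`).  Then it holds for every finite edge system on `V`.
Strong induction on the number of edges; the reducible cases are `card_lSet_grade_le_of_oneSum`,
`card_lSet_grade_le_of_twoCut'` and the degenerate placements. [this work] -/
theorem card_lSet_grade_le_of_irreducible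
    (Hirr : ∀ (ι : Type u₀) [Fintype ι] [DecidableEq ι] (ends : ι → Sym2 V) (a b c : V),
      a ≠ b → a ≠ c → b ≠ c → (∃ i, a ∈ ends i) → (∃ i, b ∈ ends i) → (∃ i, c ∈ ends i) →
      (¬ ∃ (S : Finset ι) (h : V), S.Nonempty ∧ Sᶜ.Nonempty ∧
          ∀ w, (∃ i ∈ S, w ∈ ends i) → (∃ j ∉ S, w ∈ ends j) → w = h) →
      (¬ ∃ (S : Finset ι) (u v : V), u ≠ v ∧ 2 ≤ S.card ∧ Sᶜ.Nonempty ∧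
          (∀ w, (∃ i ∈ S, w ∈ ends i) → (∃ j ∉ S, w ∈ ends j) → w = u ∨ w = v) ∧
          (∀ j ∈ S, a ∈ ends j → a = u ∨ a = v) ∧ (∀ j ∈ S, b ∈ ends j → b = u ∨ b = v) ∧
          (∀ j ∈ S, c ∈ ends j → c = u ∨ c = v)) →
      ∀ t : ℕ, (univ.filter fun x : ι → Bool => x ∈ lSet ends a b c ∧
        (Nat.card (fromEdgeSet {s : Sym2 V | ∃ i, x i = true ∧ ends i = s}).ConnectedComponent +
        Nat.card (fromEdgeSet {s : Sym2 V | ∃ i, x i = false ∧ ends i = s}).ConnectedComponent) =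
          t).card ≤
      (univ.filter fun x : ι → Bool => x ∈ rSet ends a b c ∧
        (Nat.card (fromEdgeSet {s : Sym2 V | ∃ i, x i = true ∧ ends i = s}).ConnectedComponent +
        Nat.card (fromEdgeSet {s : Sym2 V | ∃ i, x i = false ∧ ends i = s}).ConnectedComponent) =
          t).card)
    {ι : Type u₀} [Fintype ι] [DecidableEq ι] (ends : ι → Sym2 V) (a b c : V) (t : ℕ) :
    (univ.filter fun x : ι → Bool => x ∈ lSet ends a b c ∧
        (Nat.card (fromEdgeSet {s : Sym2 V | ∃ i, x i = true ∧ ends i = s}).ConnectedComponent +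
        Nat.card (fromEdgeSet {s : Sym2 V | ∃ i, x i = false ∧ ends i = s}).ConnectedComponent) =
          t).card ≤
      (univ.filter fun x : ι → Bool => x ∈ rSet ends a b c ∧
        (Nat.card (fromEdgeSet {s : Sym2 V | ∃ i, x i = true ∧ ends i = s}).ConnectedComponent +
        Nat.card (fromEdgeSet {s : Sym2 V | ∃ i, x i = false ∧ ends i = s}).ConnectedComponent) =
          t).card := by
  suffices key : ∀ (n : ℕ) (κ : Type u₀) [Fintype κ] [DecidableEq κ], Fintype.card κ = n →
      ∀ (ends : κ → Sym2 V) (a b c : V) (t : ℕ),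
      (univ.filter fun x : κ → Bool => x ∈ lSet ends a b c ∧
        (Nat.card (fromEdgeSet {s : Sym2 V | ∃ i, x i = true ∧ ends i = s}).ConnectedComponent +
        Nat.card (fromEdgeSet {s : Sym2 V | ∃ i, x i = false ∧ ends i = s}).ConnectedComponent) =
          t).card ≤
      (univ.filter fun x : κ → Bool => x ∈ rSet ends a b c ∧
        (Nat.card (fromEdgeSet {s : Sym2 V | ∃ i, x i = true ∧ ends i = s}).ConnectedComponent +
        Nat.card (fromEdgeSet {s : Sym2 V | ∃ i, x i = false ∧ ends i = s}).ConnectedComponent) =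
          t).card from key _ ι rfl ends a b c t
  refine fun n => Nat.strong_induction_on n fun n ih => ?_
  intro κ _ _ hκ ends a b c t
  -- the induction hypothesis for an index type with fewer elements
  have IH : ∀ (κ' : Type u₀) [Fintype κ'] [DecidableEq κ'], Fintype.card κ' < Fintype.card κ →
      ∀ (ends' : κ' → Sym2 V) (a' b' c' : V) (t : ℕ),
      (univ.filter fun x : κ' → Bool => x ∈ lSet ends' a' b' c' ∧
        (Nat.card (fromEdgeSet {s : Sym2 V | ∃ i, x i = true ∧ ends' i = s}).ConnectedComponent +
        Nat.card (fromEdgeSet {s : Sym2 V | ∃ i, x i = false ∧ ends' i = s}).ConnectedComponent) =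
          t).card ≤
      (univ.filter fun x : κ' → Bool => x ∈ rSet ends' a' b' c' ∧
        (Nat.card (fromEdgeSet {s : Sym2 V | ∃ i, x i = true ∧ ends' i = s}).ConnectedComponent +
        Nat.card (fromEdgeSet {s : Sym2 V | ∃ i, x i = false ∧ ends' i = s}).ConnectedComponent) =
          t).card :=
    fun κ' _ _ hlt ends' a' b' c' t => ih _ (hκ ▸ hlt) κ' rfl ends' a' b' c' t
  -- degenerate placements
  by_cases hab : a = b
  · subst hab
    exact card_lSet_grade_le_of_lSet_eq_empty ends a a c (lSet_eq_empty_of_apex_eq_left ends a c) t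
  by_cases hac : a = c
  · subst hac
    exact card_lSet_grade_le_of_lSet_eq_empty ends a b a (lSet_eq_empty_of_apex_eq_right ends a b) t
  by_cases hbc : b = c
  · subst hbc
    exact card_lSet_grade_le_of_lSet_eq_empty ends a b b (lSet_self ends a b) t
  by_cases hma : ∃ i, a ∈ ends i
  swap
  · exact card_lSet_grade_le_of_lSet_eq_empty ends a b c
      (lSet_eq_empty_of_not_met_apex ends a b c (Ne.symm hab) fun i hi => hma ⟨i, hi⟩) t
  by_cases hmb : ∃ i, b ∈ ends i
  swap
  · exact card_lSet_grade_le_of_lSet_eq_empty ends a b c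
      (lSet_eq_empty_of_not_met_left ends a b c (Ne.symm hab) fun i hi => hmb ⟨i, hi⟩) t
  by_cases hmc : ∃ i, c ∈ ends i
  swap
  · exact card_lSet_grade_le_of_lSet_eq_empty ends a b c
      (lSet_eq_empty_of_not_met_right ends a b c (Ne.symm hac) fun i hi => hmc ⟨i, hi⟩) t
  -- 1-sums
  by_cases h1 : ∃ (S : Finset κ) (h : V), S.Nonempty ∧ Sᶜ.Nonempty ∧
      ∀ w, (∃ i ∈ S, w ∈ ends i) → (∃ j ∉ S, w ∈ ends j) → w = h
  · obtain ⟨S, h, hS, hSc, hmeet⟩ := h1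
    have ltS : Fintype.card {i // i ∈ S} < Fintype.card κ := by
      obtain ⟨j, hj⟩ := hSc
      exact Fintype.card_subtype_lt (p := fun i => i ∈ S) (x := j) (Finset.mem_compl.1 hj)
    have ltSc : Fintype.card {i // i ∉ S} < Fintype.card κ := by
      obtain ⟨i, hi⟩ := hS
      exact Fintype.card_subtype_lt (p := fun i => i ∉ S) (x := i) (not_not.2 hi)
    by_cases haS : a = h ∨ ∃ i ∈ S, a ∈ ends i
    · exact card_lSet_grade_le_of_oneSum ends a b c S h hmeet hab hac hbc hmb hmc haS
        (IH _ ltS _) (IH _ ltSc _) t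
    · -- `a` strictly inside `Sᶜ`: use the complementary splitting
      obtain ⟨i₀, hi₀⟩ := hma
      have hi₀S : i₀ ∉ S := fun h' => haS (Or.inr ⟨i₀, h', hi₀⟩)
      have hmeet' : ∀ w, (∃ i ∈ Sᶜ, w ∈ ends i) → (∃ j ∉ Sᶜ, w ∈ ends j) → w = h :=
        fun w ⟨i, hi, hwi⟩ ⟨j, hj, hwj⟩ =>
          hmeet w ⟨j, not_not.1 (fun h' => hj (Finset.mem_compl.2 h')), hwj⟩
            ⟨i, Finset.mem_compl.1 hi, hwi⟩
      have ltS' : Fintype.card {i // i ∈ Sᶜ} < Fintype.card κ := by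
        obtain ⟨i, hi⟩ := hS
        exact Fintype.card_subtype_lt (p := fun i => i ∈ Sᶜ) (x := i)
          (fun h' => Finset.mem_compl.1 h' hi)
      have ltSc' : Fintype.card {i // i ∉ Sᶜ} < Fintype.card κ := by
        obtain ⟨j, hj⟩ := hSc
        exact Fintype.card_subtype_lt (p := fun i => i ∉ Sᶜ) (x := j) (not_not.2 hj)
      exact card_lSet_grade_le_of_oneSum ends a b c Sᶜ h hmeet' hab hac hbc hmb hmc
        (Or.inr ⟨i₀, Finset.mem_compl.2 hi₀S, hi₀⟩) (IH _ ltS' _) (IH _ ltSc' _) t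
  -- terminal-free sides of 2-separations
  by_cases h2 : ∃ (S : Finset κ) (u v : V), u ≠ v ∧ 2 ≤ S.card ∧ Sᶜ.Nonempty ∧
      (∀ w, (∃ i ∈ S, w ∈ ends i) → (∃ j ∉ S, w ∈ ends j) → w = u ∨ w = v) ∧
      (∀ j ∈ S, a ∈ ends j → a = u ∨ a = v) ∧ (∀ j ∈ S, b ∈ ends j → b = u ∨ b = v) ∧
      (∀ j ∈ S, c ∈ ends j → c = u ∨ c = v)
  · obtain ⟨S, u, v, huv, hS2, hSc, hmeet, haS, hbS, hcS⟩ := h2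
    have hendsB : ∀ i', (Sum.elim (fun i : {i // i ∉ S} => ends ↑i) (fun i : {i // i ∈ S} => ends ↑i)) i' =
        ends (((Equiv.sumComm _ _).trans (Equiv.sumCompl fun i => i ∈ S)) i') := by
      rintro (i | i) <;> simp
    have cS : Fintype.card {i // i ∈ S} = S.card := Fintype.card_coe S
    have cSc : Fintype.card {i // i ∉ S} = Fintype.card κ - Fintype.card {i // i ∈ S} :=
      Fintype.card_subtype_compl fun i => i ∈ S
    have cle : S.card ≤ Fintype.card κ := by
      rw [← cS]; exact Fintype.card_subtype_le _
    have lt1 : Fintype.card {i // i ∉ S} < Fintype.card κ := by rw [cSc, cS]; omega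
    have lt2 : Fintype.card ({i // i ∉ S} ⊕ Unit) < Fintype.card κ := by
      rw [Fintype.card_sum, Fintype.card_unit, cSc, cS]; omega
    rw [← card_lSet_grade_eq_of_equiv ((Equiv.sumComm _ _).trans (Equiv.sumCompl fun i => i ∈ S))
        ends (Sum.elim (fun i : {i // i ∉ S} => ends ↑i) (fun i : {i // i ∈ S} => ends ↑i)) hendsB a b c t,
      ← card_rSet_grade_eq_of_equiv ((Equiv.sumComm _ _).trans (Equiv.sumCompl fun i => i ∈ S))
        ends (Sum.elim (fun i : {i // i ∉ S} => ends ↑i) (fun i : {i // i ∈ S} => ends ↑i)) hendsB a b c t]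
    exact card_lSet_grade_le_of_twoCut' (fun i : {i // i ∉ S} => ends ↑i) (fun i : {i // i ∈ S} => ends ↑i) u v a b c huv
      (fun w i hi j hj => hmeet w ⟨j.1, j.2, hj⟩ ⟨i.1, i.2, hi⟩)
      (fun j hj => haS j.1 j.2 hj) (fun j hj => hbS j.1 j.2 hj) (fun j hj => hcS j.1 j.2 hj)
      (IH _ lt1 (fun i : {i // i ∉ S} => ends ↑i) a b c)
      (IH _ lt2 (Sum.elim (fun i : {i // i ∉ S} => ends ↑i) (fun _ : Unit => s(u, v))) a b c)
      (IH _ lt1 (fun i => ((fun i : {i // i ∉ S} => ends ↑i) i).map fun w => if w = v then u else w)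
        (if a = v then u else a) (if b = v then u else b) (if c = v then u else c)) t
  -- irreducible
  exact Hirr κ ends a b c hab hac hbc hma hmb hmc h1 h2 t

open Classical in
open Literature.Probability.Percolation (BondConfig) in
open Literature.Probability.Percolation.Gladkov (cl) in
open Literature.Probability.LatticeModels (rcMeasureW) in
open RefinedRowR3 (Sep) in
/-- **LEMMA F from irreducible instances.**  ANTI₁-GRADED on the irreducible instances on `V` alone
implies the refined row R1 `φ(T)·φ(S_a) ≤ φ(U_b)·φ(U_c)` for `φ = rcMeasureW w q ∅`, every `q > 0` and every
edge-weight vector supported in `D₀` (`r1_rc_of_graded_anti1` ∘ `card_lSet_grade_le_of_irreducible`).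
[this work] -/
theorem r1_rc_of_irreducible_graded_anti1
    (Hirr : ∀ (ι : Type u₀) [Fintype ι] [DecidableEq ι] (ends : ι → Sym2 V) (a b c : V),
      a ≠ b → a ≠ c → b ≠ c → (∃ i, a ∈ ends i) → (∃ i, b ∈ ends i) → (∃ i, c ∈ ends i) →
      (¬ ∃ (S : Finset ι) (h : V), S.Nonempty ∧ Sᶜ.Nonempty ∧
          ∀ w, (∃ i ∈ S, w ∈ ends i) → (∃ j ∉ S, w ∈ ends j) → w = h) →
      (¬ ∃ (S : Finset ι) (u v : V), u ≠ v ∧ 2 ≤ S.card ∧ Sᶜ.Nonempty ∧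
          (∀ w, (∃ i ∈ S, w ∈ ends i) → (∃ j ∉ S, w ∈ ends j) → w = u ∨ w = v) ∧
          (∀ j ∈ S, a ∈ ends j → a = u ∨ a = v) ∧ (∀ j ∈ S, b ∈ ends j → b = u ∨ b = v) ∧
          (∀ j ∈ S, c ∈ ends j → c = u ∨ c = v)) →
      ∀ t : ℕ, (univ.filter fun x : ι → Bool => x ∈ lSet ends a b c ∧
        (Nat.card (fromEdgeSet {s : Sym2 V | ∃ i, x i = true ∧ ends i = s}).ConnectedComponent +
        Nat.card (fromEdgeSet {s : Sym2 V | ∃ i, x i = false ∧ ends i = s}).ConnectedComponent) =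
          t).card ≤
      (univ.filter fun x : ι → Bool => x ∈ rSet ends a b c ∧
        (Nat.card (fromEdgeSet {s : Sym2 V | ∃ i, x i = true ∧ ends i = s}).ConnectedComponent +
        Nat.card (fromEdgeSet {s : Sym2 V | ∃ i, x i = false ∧ ends i = s}).ConnectedComponent) =
          t).card)
    (w : Sym2 V → unitInterval) {q : ℝ} (hq : 0 < q) (D₀ : Finset (Sym2 V))
    (hw : ∀ e, e ∉ D₀ → (w e : ℝ) = 0) (a b c : V) :
    (rcMeasureW w q ∅).real {η : BondConfig V | b ∈ cl η.toFinset a ∧ c ∈ cl η.toFinset a} *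
        (rcMeasureW w q ∅).real {η : BondConfig V | b ∉ cl η.toFinset a ∧ c ∉ cl η.toFinset a ∧
          Sep D₀ (cl η.toFinset a) b c} ≤
      (rcMeasureW w q ∅).real {η : BondConfig V | b ∈ cl η.toFinset a ∧ c ∉ cl η.toFinset a} *
        (rcMeasureW w q ∅).real {η : BondConfig V | b ∉ cl η.toFinset a ∧ c ∈ cl η.toFinset a} :=
  r1_rc_of_graded_anti1 (fun _ ends' a b c t => card_lSet_grade_le_of_irreducible Hirr ends' a b c t)
    w hq D₀ hw a b c

end Induction

end AntipodalR1

end Summit.CriticalPhenomena.PercolationContinuityZ3.Theorems
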